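import Summits.AnomalousDissipation.AnomalousDissipation.Theorems.SolenoidalFractalHomogenisationLagrangianStepSidebandXDefectLinks
import HarnessLib

/-!
# K1L_D `LagrangianRenormalisationStepDesign` (stmt-AnomalousDissipation-27980), `stub_D1_V0` (V0 = clause (ii) of
# `WCrossing.D1ExactFamily`), brick T4c-3 (tail): THE TRUNCATION TAIL COMPONENT IS `≤ (2π|k_z|/n)·Σⱼ‖αⱼ‖·(outside neighbours)` and pairs with the
# residual against the DISSIPATION WEIGHT `|k_z|²` (helper; `--kind proof --supports stmt-AnomalousDissipation-27980 --as helper`)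

Summits-side helper file of route `SolenoidalFractalHomogenisation` (prover seat `ad-k1l-cellLawV-w1` g6).  Everything proved; no definitions, no named
facts, no sorry.  Defect group D4 of `…SidebandXResidual.hasDerivWithinAt_residual` (memo `Cruxes/LagrangianRenormalisationStepDesign/Lines/onelevel-V0-residual.md`
§3): the link coefficient at a class point grows like `|k_z| = |ℓ + n·z|` (≈ `n·R` at the box boundary), so the tail is NOT small in `L²`-time by itself; it
is paired with `r_z` by Young against the dissipation weight `|k_z|²‖r_z‖²` kept by `…SidebandXResidual.two_inner_genX_add_le`, after which only the
OUTSIDE amplitudes `Σ_{w ∉ box ∪ {0}} ‖modeRep(k_w)‖²` remain, whose time integral the energy package (`CellChain.exists_energyRep_cell`) makes `O(E₀/(ν R²))`.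
* `norm_linkCoeff_classFreq_le` — `|linkCoeffⱼ(k_z,t)| ≤ 2π·√|k_z|²/n`;
* **`norm_tailVec_apply_le`** — `‖(tailVec t)_z‖ ≤ (2π√|k_z|²/n)·Σⱼ ‖αⱼ‖·(‖[z−mⱼ outside]·y(k_{z−mⱼ})‖ + ‖[z+mⱼ outside]·y(k_{z+mⱼ})‖)`;
* **`two_mul_re_inner_le_of_weight`** — the Young split `2|Re⟪a, b⟫| ≤ ε·W·‖a‖² + ‖b‖²/(ε·W)` (`ε, W > 0`), and
  **`two_abs_re_inner_tail_le`** — `2|Re⟪r_z, (tailVec t)_z⟫| ≤ ε|k_z|²‖r_z‖² + (4π²/(ε n²))·(Σⱼ ‖αⱼ‖(‖o⁻ⱼ‖ + ‖o⁺ⱼ‖))²` (`k_z ≠ 0`): the `|k_z|` growth is gone.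
NOT a proof of any registered stub, of K1L_D, or of anomalous dissipation; rung F-D1.A0 infrastructure.
-/

set_option linter.dupNamespace false

noncomputable section

namespace Summit.AnomalousDissipation.AnomalousDissipation.Theorems.SolenoidalFractalHomogenisation.LagrangianStep.Sideband

open Set MeasureTheory Complex UnitAddTorus
open scoped InnerProductSpace
open Literature.Analysis Literature.Analysis.FunctionSpaces Literature.Analysis.FunctionSpaces.Torus
open Literature.Analysis.FluidPDE Literature.Analysis.FluidPDE.Torus Literature.Analysis.FluidPDE.LatticeShear
open Summit.AnomalousDissipation.AnomalousDissipation.Theorems.SolenoidalFractalHomogenisation.LagrangianStep.CellChain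
  (linkCoeff modeRep norm_linkCoeff_le norm_transversalProj_le)

variable {k₀ : ℕ}

/-! ## §1 The tail component -/

/-- `|linkCoeffⱼ(k_z,t)| ≤ 2π·√|k_z|²/n`. [cite: MeshalkinSinai1961, pp. 1700–1705] -/
theorem norm_linkCoeff_classFreq_le (W₁ : LatticeWord k₀) (n : ℕ) (ℓ z : Fin 3 → ℤ) (j : Fin k₀) (t : ℝ) :
    ‖linkCoeff W₁ n (classFreq n ℓ z) j t‖ ≤ 2 * Real.pi * (Real.sqrt (freqNormSq (classFreq n ℓ z)) / n) := by
  have h := norm_linkCoeff_le W₁ n (classFreq n ℓ z) j t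
  calc _ ≤ 2 * Real.pi * ‖∑ a, ((W₁.phase j).e a : ℂ) * ((classFreq n ℓ z) a)‖ * (1 / (n : ℝ)) := h
    _ ≤ 2 * Real.pi * Real.sqrt (freqNormSq (classFreq n ℓ z)) * (1 / (n : ℝ)) :=
        mul_le_mul_of_nonneg_right (mul_le_mul_of_nonneg_left (norm_sum_e_mul_le _ _) (by positivity)) (by positivity)
    _ = _ := by ring

open Classical in
/-- **The tail component**: `‖(tailVec t)_z‖ ≤ (2π√|k_z|²/n)·Σⱼ ‖αⱼ‖·(‖[z−mⱼ outside]·y(k_{z−mⱼ},t)‖ + ‖[z+mⱼ outside]·y(k_{z+mⱼ},t)‖)`.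
[cite: MajdaKramer1999, §2.2.1.3] [cite: MeshalkinSinai1961, pp. 1700–1705] -/
theorem norm_tailVec_apply_le (W₁ : LatticeWord k₀) (n : ℕ) (𝔹 : Torus.Visc4 (Fin 3)) (F : UnitAddTorus (Fin 3) → EuclideanSpace ℝ (Fin 3))
    (u : ℝ → UnitAddTorus (Fin 3) → EuclideanSpace ℝ (Fin 3)) (ℓ : Fin 3 → ℤ) (R : ℕ) (t : ℝ) (z : box R) :
    ‖tailVec W₁ n 𝔹 F u ℓ R t z‖ ≤
      2 * Real.pi * (Real.sqrt (freqNormSq (classFreq n ℓ z.1)) / n) *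
        ∑ j, ‖slotAmp W₁ j‖ *
          (‖(if (z.1 - (W₁.phase j).m ∉ box R ∧ z.1 - (W₁.phase j).m ≠ 0) then modeRep W₁ n 𝔹 F u (classFreq n ℓ (z.1 - (W₁.phase j).m)) t else 0)‖ +
           ‖(if (z.1 + (W₁.phase j).m ∉ box R ∧ z.1 + (W₁.phase j).m ≠ 0) then modeRep W₁ n 𝔹 F u (classFreq n ℓ (z.1 + (W₁.phase j).m)) t else 0)‖) := by
  rw [tailVec_apply, norm_neg]
  refine (norm_sum_le _ _).trans ?_
  rw [Finset.mul_sum]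
  refine Finset.sum_le_sum fun j _ => ?_
  rw [norm_smul]
  have hlc := norm_linkCoeff_classFreq_le W₁ n ℓ z.1 j t
  have hα : ‖starRingEnd ℂ (slotAmp W₁ j)‖ = ‖slotAmp W₁ j‖ := Complex.norm_conj _
  have hin : ‖transversalProj (classFreq n ℓ z.1)
        (slotAmp W₁ j • (if (z.1 - (W₁.phase j).m ∉ box R ∧ z.1 - (W₁.phase j).m ≠ 0) then
            modeRep W₁ n 𝔹 F u (classFreq n ℓ (z.1 - (W₁.phase j).m)) t else 0) +
          starRingEnd ℂ (slotAmp W₁ j) • (if (z.1 + (W₁.phase j).m ∉ box R ∧ z.1 + (W₁.phase j).m ≠ 0) then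
            modeRep W₁ n 𝔹 F u (classFreq n ℓ (z.1 + (W₁.phase j).m)) t else 0))‖ ≤
      ‖slotAmp W₁ j‖ *
        (‖(if (z.1 - (W₁.phase j).m ∉ box R ∧ z.1 - (W₁.phase j).m ≠ 0) then modeRep W₁ n 𝔹 F u (classFreq n ℓ (z.1 - (W₁.phase j).m)) t else 0)‖ +
         ‖(if (z.1 + (W₁.phase j).m ∉ box R ∧ z.1 + (W₁.phase j).m ≠ 0) then modeRep W₁ n 𝔹 F u (classFreq n ℓ (z.1 + (W₁.phase j).m)) t else 0)‖) := by
    refine (norm_transversalProj_le _ _).trans ((norm_add_le _ _).trans ?_)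
    rw [norm_smul, norm_smul, hα, mul_add]
  calc _ ≤ (2 * Real.pi * (Real.sqrt (freqNormSq (classFreq n ℓ z.1)) / n)) * (‖slotAmp W₁ j‖ * _) :=
        mul_le_mul hlc hin (norm_nonneg _) (by positivity)
    _ = _ := by ring

/-! ## §2 Pairing with the residual against the dissipation weight -/

/-- **Young split against a weight**: `2|Re⟪a, b⟫| ≤ ε·W·‖a‖² + ‖b‖²/(ε·W)` for `ε, W > 0`. [folklore] -/
theorem two_mul_abs_re_inner_le_of_weight (a b : EuclideanSpace ℂ (Fin 3)) {ε W : ℝ} (hε : 0 < ε) (hW : 0 < W) :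
    2 * |(⟪a, b⟫_ℂ).re| ≤ ε * W * ‖a‖ ^ 2 + ‖b‖ ^ 2 / (ε * W) := by
  have h1 : |(⟪a, b⟫_ℂ).re| ≤ ‖a‖ * ‖b‖ := (Complex.abs_re_le_norm _).trans (norm_inner_le_norm a b)
  have hεW : 0 < ε * W := mul_pos hε hW
  -- `2xy ≤ εW x² + y²/(εW)`
  have h2 : 2 * (‖a‖ * ‖b‖) ≤ ε * W * ‖a‖ ^ 2 + ‖b‖ ^ 2 / (ε * W) := by
    have hsq : 0 ≤ (ε * W * ‖a‖ - ‖b‖) ^ 2 / (ε * W) := div_nonneg (sq_nonneg _) hεW.le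
    have hexp : (ε * W * ‖a‖ - ‖b‖) ^ 2 / (ε * W) = ε * W * ‖a‖ ^ 2 - 2 * (‖a‖ * ‖b‖) + ‖b‖ ^ 2 / (ε * W) := by
      field_simp
      ring
    linarith [hsq, hexp]
  linarith

open Classical in
/-- **THE TAIL PAIRED WITH THE RESIDUAL**: for `k_z ≠ 0` and `ε > 0`,
`2|Re⟪r_z, (tailVec t)_z⟫| ≤ ε·|k_z|²·‖r_z‖² + (4π²/(ε·n²))·(Σⱼ ‖αⱼ‖(‖o⁻ⱼ‖ + ‖o⁺ⱼ‖))²` — the `|k_z|`-growth of the tail is traded against the dissipation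
weight. [cite: MajdaKramer1999, §2.2.1.3] -/
theorem two_abs_re_inner_tail_le (W₁ : LatticeWord k₀) {n : ℕ} (hn : n ≠ 0) (𝔹 : Torus.Visc4 (Fin 3)) (F : UnitAddTorus (Fin 3) → EuclideanSpace ℝ (Fin 3))
    (u : ℝ → UnitAddTorus (Fin 3) → EuclideanSpace ℝ (Fin 3)) (ℓ : Fin 3 → ℤ) (R : ℕ) (t : ℝ) (z : box R)
    (hk : classFreq n ℓ z.1 ≠ 0) {ε : ℝ} (hε : 0 < ε) (rz : EuclideanSpace ℂ (Fin 3)) :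
    2 * |(⟪rz, tailVec W₁ n 𝔹 F u ℓ R t z⟫_ℂ).re| ≤
      ε * freqNormSq (classFreq n ℓ z.1) * ‖rz‖ ^ 2 +
        (4 * Real.pi ^ 2 / (ε * (n : ℝ) ^ 2)) *
          (∑ j, ‖slotAmp W₁ j‖ *
            (‖(if (z.1 - (W₁.phase j).m ∉ box R ∧ z.1 - (W₁.phase j).m ≠ 0) then modeRep W₁ n 𝔹 F u (classFreq n ℓ (z.1 - (W₁.phase j).m)) t else 0)‖ +
             ‖(if (z.1 + (W₁.phase j).m ∉ box R ∧ z.1 + (W₁.phase j).m ≠ 0) then modeRep W₁ n 𝔹 F u (classFreq n ℓ (z.1 + (W₁.phase j).m)) t else 0)‖)) ^ 2 := by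
  have hW : 0 < freqNormSq (classFreq n ℓ z.1) := freqNormSq_pos_of_ne_zero' hk
  have hn0 : (0 : ℝ) < n := by exact_mod_cast Nat.pos_of_ne_zero hn
  set S := ∑ j, ‖slotAmp W₁ j‖ *
      (‖(if (z.1 - (W₁.phase j).m ∉ box R ∧ z.1 - (W₁.phase j).m ≠ 0) then modeRep W₁ n 𝔹 F u (classFreq n ℓ (z.1 - (W₁.phase j).m)) t else 0)‖ +
       ‖(if (z.1 + (W₁.phase j).m ∉ box R ∧ z.1 + (W₁.phase j).m ≠ 0) then modeRep W₁ n 𝔹 F u (classFreq n ℓ (z.1 + (W₁.phase j).m)) t else 0)‖)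
    with hS
  have hS0 : 0 ≤ S := Finset.sum_nonneg fun j _ => by positivity
  have h := two_mul_abs_re_inner_le_of_weight rz (tailVec W₁ n 𝔹 F u ℓ R t z) hε hW
  have htail := norm_tailVec_apply_le W₁ n 𝔹 F u ℓ R t z
  rw [← hS] at htail
  have hsq : ‖tailVec W₁ n 𝔹 F u ℓ R t z‖ ^ 2 ≤ (2 * Real.pi * (Real.sqrt (freqNormSq (classFreq n ℓ z.1)) / n) * S) ^ 2 :=
    pow_le_pow_left₀ (norm_nonneg _) htail 2
  have hF2 : Real.sqrt (freqNormSq (classFreq n ℓ z.1)) ^ 2 = freqNormSq (classFreq n ℓ z.1) := Real.sq_sqrt hW.le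
  have hbound : ‖tailVec W₁ n 𝔹 F u ℓ R t z‖ ^ 2 / (ε * freqNormSq (classFreq n ℓ z.1)) ≤ (4 * Real.pi ^ 2 / (ε * (n : ℝ) ^ 2)) * S ^ 2 := by
    rw [div_le_iff₀ (mul_pos hε hW)]
    calc ‖tailVec W₁ n 𝔹 F u ℓ R t z‖ ^ 2 ≤ (2 * Real.pi * (Real.sqrt (freqNormSq (classFreq n ℓ z.1)) / n) * S) ^ 2 := hsq
      _ = 4 * Real.pi ^ 2 / ((n : ℝ) ^ 2) * S ^ 2 * freqNormSq (classFreq n ℓ z.1) := by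
          rw [mul_pow, mul_pow, div_pow, hF2]; field_simp; ring
      _ = 4 * Real.pi ^ 2 / (ε * (n : ℝ) ^ 2) * S ^ 2 * (ε * freqNormSq (classFreq n ℓ z.1)) := by field_simp
  linarith [h, hbound]

end Summit.AnomalousDissipation.AnomalousDissipation.Theorems.SolenoidalFractalHomogenisation.LagrangianStep.Sideband

end
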